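import Summits.NavierStokesRegularity.TurbBounds.Results.P2R3Tail
import Summits.NavierStokesRegularity.TurbBounds.Results.P2R4Tail
import Summits.NavierStokesRegularity.TurbBounds.P2Profile
import HarnessLib

/-!
# Theorem 1 (P2-R4) and the rung P2-R3 from the CITED reduction ALONE — composition of the proved tail lemmas with `SpectralReduction`
(cell `pub-turb` / `turb-bounds`, v2 lane; composition file — lands LAST, after BOTH staged v2 sets are in the tree:
pub-turb-cert's `lean-tail-v2/tailgen/` (`Results/P2R3Tail`, `Results/P2R4Tail`: the tail lemmas PROVED) and pub-turb-sos's `lean-v2/`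
(`SpectralForm`, `P2Profile`: `layerReduction_of_spectralReduction`, R-P2a/R-P2b PROVED). Written by pub-turb-cert, prover-pub-turb-cert-g6-0.)

HONEST FRAMING: rigorous bounds for the stated PDE and boundary conditions; no claim about physical turbulence beyond the bound.
RESULT: `P2R4.nusselt_bound_of_spectralReduction' (Nu) (h : SpectralReduction Nu) : ∀ Ra ≥ 485809/4, Nu Ra ≤ C·√Ra − 1/2`,
`C = 4323705766579/144644500000000` — the paper's THEOREM 1 from ONE hypothesis which is the published reduction transcribed mode-wise from
[cite: DingKerswell2019, (13)–(16)] / [DC96] (decision 112 (C): a transcription); bulk drop, rescaling, Legendre tail lemma, the 119-LMI finite certificate with its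
interval evaluator, cutoff, cover and member arithmetic are ALL kernel-checked. Likewise the rung P2-R3. And, with NO hypothesis at all:
`P2R3/P2R4.spectralConstraint_holds` — the spectral constraint (A1) itself (`Q_k ≥ 0` for every `k > 0` on the two-sided no-slip class) for
the explicit certified profiles at every admissible `Ra` (as `Results.P2Spectral.P2R0.spectralConstraint_holds` does for P2-R0).
NOT CLAIMED: the passage (A1) ⇒ Nusselt bound (the PDE energy argument of the cited theorem) — that IS `SpectralReduction`; nothing about physical turbulence.
-/

set_option linter.style.longLine false

noncomputable section

namespace Summit.NavierStokesRegularity.TurbBounds.Results.P2Spectral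

open Summit.NavierStokesRegularity.TurbBounds.LayerForm Summit.NavierStokesRegularity.TurbBounds.SpectralForm
open Summit.NavierStokesRegularity.TurbBounds.P2Profile

/-- **(A1) for the P2-R3 profile, unconditional.** For every `Ra ≥ 116964 = 4·171²`, the mode forms of the member `(3/2, 171, η′₅)` (layers of
thickness `δ = 171/√Ra`) are `≥ 0` for all `k > 0` on the two-sided class. -/
theorem P2R3.spectralConstraint_holds :
    ∀ Ra : ℝ, (116964 : ℝ) ≤ Ra → SpectralConstraint Ra (3 / 2) (tauP (171 / Real.sqrt Ra) Results.P2R3.eta) :=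
  fun Ra hRa => spectralConstraint_tauP (by norm_num) (by norm_num) Results.P2R3.eta_continuous.continuousOn
    TailP2R3.layer_positivity_holds (le_trans (by norm_num) hRa)

/-- **(A1) for the P2-R4 profile (Theorem 1's member), unconditional.** For every `Ra ≥ 485809/4 = 4·(697/4)²`, the mode forms of the member
`(3/2, 697/4, η′₈)` (layers of thickness `δ = (697/4)/√Ra`) are `≥ 0` for all `k > 0` on the two-sided class. -/
theorem P2R4.spectralConstraint_holds :
    ∀ Ra : ℝ, ((485809 : ℝ) / 4) ≤ Ra → SpectralConstraint Ra (3 / 2) (tauP (((697 : ℝ) / 4) / Real.sqrt Ra) Results.P2R4.eta) :=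
  fun Ra hRa => spectralConstraint_tauP (by norm_num) (by norm_num) Results.P2R4.eta_continuous.continuousOn
    TailP2R4.layer_positivity_holds (le_trans (by norm_num) hRa)

/-- **Rung P2-R3 from the cited theorem alone**: `Nu(Ra) ≤ (24231938953/790020000000)·Ra^{1/2} − 1/2` for every `Ra ≥ 116964`. -/
theorem P2R3.nusselt_bound_of_spectralReduction' (Nu : ℝ → ℝ) (h : SpectralReduction Nu) :
    ∀ Ra : ℝ, (116964 : ℝ) ≤ Ra → Nu Ra ≤ ((24231938953 : ℝ) / 790020000000) * Real.sqrt Ra - 1 / 2 :=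
  Results.P2R3.nusselt_bound Nu (layerReduction_of_spectralReduction Nu h) TailP2R3.tailLemma

/-- **THEOREM 1 (row P2-R4) from the cited theorem alone**: for every quantity `Nu` obeying the affine background-method reduction in mode form
(`SpectralReduction`, transcribed mode-wise from [cite: DingKerswell2019, (13)–(16)] / [DC96]), `Nu(Ra) ≤ (4323705766579/144644500000000)·Ra^{1/2} − 1/2` for every
`Ra ≥ 485809/4`. Every cell-made step is kernel-checked. -/
theorem P2R4.nusselt_bound_of_spectralReduction' (Nu : ℝ → ℝ) (h : SpectralReduction Nu) :
    ∀ Ra : ℝ, ((485809 : ℝ) / 4) ≤ Ra → Nu Ra ≤ ((4323705766579 : ℝ) / 144644500000000) * Real.sqrt Ra - 1 / 2 :=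
  Results.P2R4.nusselt_bound Nu (layerReduction_of_spectralReduction Nu h) TailP2R4.tailLemma

/-- Printed form of Theorem 1 from the cited theorem alone: `Nu(Ra) ≤ 0.029892·Ra^{1/2} − 1/2` for every `Ra ≥ 485809/4`. -/
theorem P2R4.nusselt_bound_decimal_of_spectralReduction' (Nu : ℝ → ℝ) (h : SpectralReduction Nu) :
    ∀ Ra : ℝ, ((485809 : ℝ) / 4) ≤ Ra → Nu Ra ≤ ((7473 : ℝ) / 250000) * Real.sqrt Ra - 1 / 2 :=
  Results.P2R4.nusselt_bound_decimal Nu (layerReduction_of_spectralReduction Nu h) TailP2R4.tailLemma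

end Summit.NavierStokesRegularity.TurbBounds.Results.P2Spectral

end
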